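import Summits.CriticalPhenomena.PercolationContinuityZ3.Theorems.PercNearOneGluingNoHeavyLowerTailSahiCTCLadderThreeRowOneDense
import Summits.CriticalPhenomena.PercolationContinuityZ3.Theorems.PercNearOneGluingNoHeavyLowerTailSahiCTCKleitmanPinnedT
import HarnessLib

/-!
# `NoHeavyLowerTail` (crux stmt-CriticalPhenomena-4575), P3 lane: the row `#dbl = 1` of the ladder `(L_t)`, all `t` — cubes, charge, facts

Support file (seat `prim-l12-p3`, gen 26; `--supports stmt-CriticalPhenomena-4575`).  Memo g26 §4.14.  For every level `t ≥ 2` and a profile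
`m = 2·1_d + 1_T` (`τ = #T`, `n = τ − t + 1`): the cubes of `[m](e_t·H)` are the restrictions `κ(∅, d ∪ T∖Q)` (`Q ⊆ T`, `#Q = t−1`;
`n + 1` points, `t`-live) and the links `κ({d}, T∖E)` (`#E = t`; `n − 1` points, `(t−1)`-live); the charge is at most
`cH(t,n+1)·g + cH(t−1,n−1)·ε` (`g` common `d`-sets `d ∪ Q'`, `ε` common `t`-subsets of `T`).  Three summed bounds, normalised
(`rowOneT_facts`): PLAIN t-DENSITY on the restrictions `cH(t,n+1)·(t n g + t(n+1−t) ε) ≤ n(n+1)·ΣR`, PINNED t-density at `d`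
`n·cH(t,n)·g + t·cH(t−1,n)·ε ≤ n·ΣR`, and `(t−1)`-DENSITY on the links `n·cH(t−1,n−1)·g ≤ t·ΣL`.  Nothing is asserted about the crux.
-/

namespace Summit.CriticalPhenomena.PercolationContinuityZ3.Theorems.SahiCTCForms

open Finset MvPolynomial SahiCTCGenFun SahiCTCWeightedLYM

variable {α : Type*} [DecidableEq α] [Fintype α]

section RowOneT
variable {𝒳 𝒵 : Finset (Finset α)}

/-- **Cubes of the row `#dbl = 1` of `(L_t)`**: `Σ_{#Q = t−1} κ(∅, d ∪ T∖Q) + Σ_{#E = t} κ({d}, T∖E) ≤ [m](e_t·H)`. [this work] -/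
theorem cubes_le_coeff_ee_mul_harris_rowOneT (h𝒳 : IsUpperSet (𝒳 : Set (Finset α))) (h𝒵 : IsUpperSet (𝒵 : Set (Finset α)))
    {t : ℕ} (ht : 1 ≤ t) {m : α →₀ ℕ} (hm : ∀ i, m i ≤ 2) (hD : #(dbl m) = 1) {d : α} (hd : d ∈ dbl m) :
    ∑ Q ∈ (lev m 1).powersetCard (t - 1), kap 𝒳 𝒵 ∅ (insert d (lev m 1 \ Q)) + ∑ E ∈ (lev m 1).powersetCard t, kap 𝒳 𝒵 {d} (lev m 1 \ E) ≤
      (ee t * (PiP * gf (𝒳 ∩ 𝒵) - gf 𝒳 * gf 𝒵)).coeff m := by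
  have hdT : d ∉ lev m 1 := fun h => disjoint_left.1 (disjoint_dbl_lev_one m) hd h
  have hDeq := dbl_eq_singleton_of_card hD hd
  set S₁ := ((lev m 1).powersetCard (t - 1)).image fun Q => insert d Q
  set S₂ := (lev m 1).powersetCard t
  have hadm : S₁ ∪ S₂ ⊆ (bySize (· = t) : Finset (Finset α)).filter fun E => ind E ≤ m := by
    intro E hE
    rw [mem_filter, bySize, mem_filter, SahiAllButC.ind_le_iff_subset_support, support_eq_dbl_union_lev hm, hDeq]
    refine ⟨⟨mem_powerset.2 (subset_univ _), ?_⟩, ?_⟩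
    · rcases mem_union.1 hE with hE | hE
      · obtain ⟨Q, hQ, rfl⟩ := mem_image.1 hE
        obtain ⟨hQT, hQ2⟩ := mem_powersetCard.1 hQ
        rw [card_insert_of_notMem (fun h => hdT (hQT h)), hQ2]; omega
      · exact (mem_powersetCard.1 hE).2
    · rcases mem_union.1 hE with hE | hE
      · obtain ⟨Q, hQ, rfl⟩ := mem_image.1 hE
        exact insert_subset (mem_union_left _ (mem_singleton_self d)) ((mem_powersetCard.1 hQ).1.trans subset_union_right)
      · exact (mem_powersetCard.1 hE).1.trans subset_union_right
  have hdisj : Disjoint S₁ S₂ := disjoint_left.2 fun E h1 h2 => by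
    obtain ⟨Q, _, rfl⟩ := mem_image.1 h1
    exact hdT ((mem_powersetCard.1 h2).1 (mem_insert_self d Q))
  have hinj : Set.InjOn (fun Q : Finset α => insert d Q) ↑((lev m 1).powersetCard (t - 1)) := fun Q hQ Q' hQ' h => by
    have hQ := (mem_powersetCard.1 (Finset.mem_coe.1 hQ)).1
    have hQ' := (mem_powersetCard.1 (Finset.mem_coe.1 hQ')).1
    have := congrArg (fun s => Finset.erase s d) h
    simp only [erase_insert (fun h => hdT (hQ h)), erase_insert (fun h => hdT (hQ' h))] at this
    exact this
  have hsur := sum_le_coeff_ee_mul_harris h𝒳 h𝒵 t m hadm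
  rw [sum_union hdisj, sum_image hinj,
    sum_congr rfl fun Q hQ => coeff_harris_cube_rowOne_R hm hD hd (mem_powersetCard.1 hQ).1,
    sum_congr rfl fun E hE => coeff_harris_cube_rowOne_L hm hD hd (mem_powersetCard.1 hE).1] at hsur
  exact hsur

/-- **Charge of the row `#dbl = 1` of `(L_t)`**: for a family `W` of `t`-sets (`t ≥ 2`, `τ ≥ t`),
`[m](Θ_{t−1}·e_{≥t}·GF(W)) ≤ cH(t, τ−t+2)·#{Q : d+Q ∈ W} + cH(t−1, τ−t)·#{E ⊆ T : E ∈ W}`. [this work] -/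
theorem coeff_chargeT_rowOneT_le {t : ℕ} (ht : 2 ≤ t) {m : α →₀ ℕ} (hm : ∀ i, m i ≤ 2) (hD : #(dbl m) = 1) {d : α} (hd : d ∈ dbl m)
    (hτ : t ≤ #(lev m 1)) (W : Finset (Finset α)) (hW : ∀ w ∈ W, #w = t) :
    (gf (bySize (· ≤ t - 1) : Finset (Finset α)) * gf (bySize (t ≤ ·) : Finset (Finset α)) * gf W).coeff m ≤
      (cH t (#(lev m 1) - t + 2) : ℤ) * #(((lev m 1).powersetCard (t - 1)).filter fun Q => insert d Q ∈ W) +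
        (cH (t - 1) (#(lev m 1) - t) : ℤ) * #(((lev m 1).powersetCard t).filter fun E => E ∈ W) := by
  rw [coeff_chargeT_eq_sum]
  have hdT : d ∉ lev m 1 := fun h => disjoint_left.1 (disjoint_dbl_lev_one m) hd h
  have hDeq := dbl_eq_singleton_of_card hD hd
  set Wm := W.filter fun w => ind w ≤ m
  have hsuppw : ∀ w ∈ Wm, w ⊆ insert d (lev m 1) := fun w hw => by
    have := (SahiAllButC.ind_le_iff_subset_support _ _).1 (mem_filter.1 hw).2
    rw [support_eq_dbl_union_lev hm, hDeq] at this
    rw [insert_eq]; exact this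
  have hval : ∀ w ∈ Wm, (gf (bySize (· ≤ t - 1) : Finset (Finset α)) * gf (bySize (t ≤ ·) : Finset (Finset α))).coeff (m - ind w) =
      if d ∈ w then (cH t (#(lev m 1) - t + 2) : ℤ) else cH (t - 1) (#(lev m 1) - t) := fun w hw => by
    obtain ⟨hwW, hwm⟩ := mem_filter.1 hw
    have hwt := hW w hwW
    rw [coeff_thetaT_mul_atLeastT_eq_cH (by omega) (sub_ind_le_two_of_le_two hm w), dbl_sub_ind_of_le_two hm, sgl_sub_ind_of_le_two hm,
      hDeq]
    have hwT : #(lev m 1 \ w) + #(lev m 1 ∩ w) = #(lev m 1) := card_sdiff_add_card_inter _ _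
    split_ifs with hdw
    · have h1 : ({d} : Finset α) ∩ w = {d} := inter_eq_left.2 (singleton_subset_iff.2 hdw)
      have h2 : ({d} : Finset α) \ w = ∅ := sdiff_eq_empty_iff_subset.2 (singleton_subset_iff.2 hdw)
      have h3 : #(lev m 1 ∩ w) = t - 1 := by
        have : #(insert d (lev m 1) ∩ w) = t := by rw [inter_eq_right.2 (hsuppw w hw), hwt]
        rw [insert_inter_of_mem hdw, card_insert_of_notMem (fun h => hdT (mem_inter.1 h).1)] at this; omega
      rw [h1, h2, card_empty, card_union_of_disjoint (disjoint_singleton_left.2 fun h => hdT (mem_sdiff.1 h).1), card_singleton]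
      (congr 2; omega)
    · have h1 : ({d} : Finset α) ∩ w = ∅ := disjoint_iff_inter_eq_empty.1 (disjoint_singleton_left.2 hdw)
      have h2 : ({d} : Finset α) \ w = {d} := sdiff_eq_self_of_disjoint (disjoint_singleton_left.2 hdw)
      have h3 : #(lev m 1 ∩ w) = t := by
        have hwT' : w ⊆ lev m 1 := fun i hi => by
          have := hsuppw w hw hi; rcases mem_insert.1 this with rfl | h
          · exact absurd hi hdw
          · exact h
        rw [inter_eq_right.2 hwT', hwt]
      rw [h1, h2, card_singleton, empty_union]
      congr 2; omega
  rw [sum_congr rfl hval, sum_ite, sum_const, sum_const, nsmul_eq_mul, nsmul_eq_mul]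
  have hc1 : #(Wm.filter fun w => d ∈ w) ≤ #(((lev m 1).powersetCard (t - 1)).filter fun Q => insert d Q ∈ W) := by
    refine card_le_card_of_injOn (fun w => w.erase d) (fun w hw => ?_) (fun w hw w' hw' h => ?_)
    · obtain ⟨hw, hdw⟩ := mem_filter.1 hw
      have hwt := hW w (mem_filter.1 hw).1
      refine Finset.mem_coe.2 (mem_filter.2 ⟨mem_powersetCard.2 ⟨fun i hi => ?_, by rw [card_erase_of_mem hdw, hwt]⟩, ?_⟩)
      · have := hsuppw w hw (mem_of_mem_erase hi)
        rcases mem_insert.1 this with h | h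
        · exact absurd h (ne_of_mem_erase hi)
        · exact h
      · rw [insert_erase hdw]; exact (mem_filter.1 hw).1
    · have hdw := (mem_filter.1 (Finset.mem_coe.1 hw)).2
      have hdw' := (mem_filter.1 (Finset.mem_coe.1 hw')).2
      have := congrArg (insert d) h
      simp only [insert_erase hdw, insert_erase hdw'] at this; exact this
  have hc2 : #(Wm.filter fun w => d ∉ w) ≤ #(((lev m 1).powersetCard t).filter fun E => E ∈ W) := by
    refine card_le_card fun w hw => ?_
    obtain ⟨hw, hdw⟩ := mem_filter.1 hw
    refine mem_filter.2 ⟨mem_powersetCard.2 ⟨fun i hi => ?_, hW w (mem_filter.1 hw).1⟩, (mem_filter.1 hw).1⟩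
    have := hsuppw w hw hi; rcases mem_insert.1 this with rfl | h
    · exact absurd hi hdw
    · exact h
  have hc1' : (#(Wm.filter fun w => d ∈ w) : ℤ) ≤ #(((lev m 1).powersetCard (t - 1)).filter fun Q => insert d Q ∈ W) := by
    exact_mod_cast hc1
  have hc2' : (#(Wm.filter fun w => d ∉ w) : ℤ) ≤ #(((lev m 1).powersetCard t).filter fun E => E ∈ W) := by exact_mod_cast hc2
  have hp1 : (0 : ℤ) ≤ cH t (#(lev m 1) - t + 2) := Nat.cast_nonneg _
  have hp2 : (0 : ℤ) ≤ cH (t - 1) (#(lev m 1) - t) := Nat.cast_nonneg _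
  nlinarith

omit [Fintype α] in
/-- Pinned common `t`-sets of the cube `d ∪ s`: the common `d`-sets `d + Q` with `Q ⊆ s`. [this work] -/
theorem card_filter_le_pinnedT {T s : Finset α} {d : α} {t : ℕ} (hdT : d ∉ T) :
    #((((T.powersetCard (t - 1)).filter fun Q => insert d Q ∈ 𝒳 ∧ insert d Q ∈ 𝒵)).filter fun w => w ⊆ s)
      ≤ #((csetsT 𝒳 𝒵 ∅ (insert d s) (t - 1 + 1)).filter fun w => d ∈ w) := by
  refine card_le_card_of_injOn (fun Q => insert d Q) (fun Q hQ => ?_) (fun Q hQ Q' hQ' h => ?_)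
  · obtain ⟨hQG, hQs⟩ := mem_filter.1 (Finset.mem_coe.1 hQ)
    obtain ⟨hQ2, hX, hZ⟩ := mem_filter.1 hQG
    obtain ⟨hQT, hQc⟩ := mem_powersetCard.1 hQ2
    refine Finset.mem_coe.2 (mem_filter.2 ⟨mem_csetsT.2 ⟨insert_subset_insert d hQs, ?_, ?_, ?_⟩, mem_insert_self d Q⟩)
    · rw [card_insert_of_notMem (fun h => hdT (hQT h)), hQc]
    · rw [empty_union]; exact hX
    · rw [empty_union]; exact hZ
  · have hQT := (mem_powersetCard.1 (mem_filter.1 (mem_filter.1 (Finset.mem_coe.1 hQ)).1).1).1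
    have hQT' := (mem_powersetCard.1 (mem_filter.1 (mem_filter.1 (Finset.mem_coe.1 hQ')).1).1).1
    have h' : insert d Q = insert d Q' := h
    rw [← erase_insert (fun h => hdT (hQT h)), h', erase_insert (fun h => hdT (hQT' h))]

omit [Fintype α] in
/-- Unpinned common `t`-sets of the cube `d ∪ s`: the common `t`-subsets of `T` inside `s`. [this work] -/
theorem card_filter_le_unpinnedT {T s : Finset α} {d : α} {t : ℕ} (hdT : d ∉ T) :
    #((((T.powersetCard t).filter fun E => E ∈ 𝒳 ∧ E ∈ 𝒵)).filter fun w => w ⊆ s)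
      ≤ #((csetsT 𝒳 𝒵 ∅ (insert d s) t).filter fun w => d ∉ w) := by
  refine card_le_card fun E hE => ?_
  obtain ⟨hEE, hEs⟩ := mem_filter.1 hE
  obtain ⟨hE3, hX, hZ⟩ := mem_filter.1 hEE
  obtain ⟨hET', hEc⟩ := mem_powersetCard.1 hE3
  refine mem_filter.2 ⟨mem_csetsT.2 ⟨hEs.trans (subset_insert d s), hEc, ?_, ?_⟩, fun h => hdT (hET' h)⟩
  · rw [empty_union]; exact hX
  · rw [empty_union]; exact hZ

omit [Fintype α] in
/-- **The three normalised supply facts of the row `#dbl = 1` of `(L_t)`** (`n = τ − t + 1`, `n + 1 ≥ 2t`): plain `t`-DENSITY and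
PINNED `t`-density at `d` on the restriction cubes, `(t−1)`-DENSITY on the link cubes. [this work] -/
theorem rowOneT_facts (h𝒳 : IsUpperSet (𝒳 : Set (Finset α))) (h𝒵 : IsUpperSet (𝒵 : Set (Finset α)))
    {t : ℕ} (ht : 2 ≤ t) (hXt : ∀ S ∈ 𝒳, t ≤ #S) (hZt : ∀ S ∈ 𝒵, t ≤ #S) {m : α →₀ ℕ} {d : α} (hd : d ∈ dbl m)
    {n : ℕ} (hn : #(lev m 1) = n + (t - 1)) (hnt : 2 * t ≤ n + 1) :
    ((cH t (n + 1) : ℤ) * (t * n * #(((lev m 1).powersetCard (t - 1)).filter fun Q => insert d Q ∈ 𝒳 ∧ insert d Q ∈ 𝒵) +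
        t * (n + 1 - t) * #(((lev m 1).powersetCard t).filter fun E => E ∈ 𝒳 ∧ E ∈ 𝒵)) ≤
      (n : ℤ) * (n + 1) * ∑ Q ∈ (lev m 1).powersetCard (t - 1), kap 𝒳 𝒵 ∅ (insert d (lev m 1 \ Q))) ∧
    ((n : ℤ) * (cH t n : ℤ) * #(((lev m 1).powersetCard (t - 1)).filter fun Q => insert d Q ∈ 𝒳 ∧ insert d Q ∈ 𝒵) +
        t * (cH (t - 1) n : ℤ) * #(((lev m 1).powersetCard t).filter fun E => E ∈ 𝒳 ∧ E ∈ 𝒵) ≤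
      (n : ℤ) * ∑ Q ∈ (lev m 1).powersetCard (t - 1), kap 𝒳 𝒵 ∅ (insert d (lev m 1 \ Q))) ∧
    ((n : ℤ) * (cH (t - 1) (n - 1) : ℤ) * #(((lev m 1).powersetCard (t - 1)).filter fun Q => insert d Q ∈ 𝒳 ∧ insert d Q ∈ 𝒵) ≤
      (t : ℤ) * ∑ E ∈ (lev m 1).powersetCard t, kap 𝒳 𝒵 {d} (lev m 1 \ E)) := by
  have hdT : d ∉ lev m 1 := fun h => disjoint_left.1 (disjoint_dbl_lev_one m) hd h
  set GT := ((lev m 1).powersetCard (t - 1)).filter fun Q => insert d Q ∈ 𝒳 ∧ insert d Q ∈ 𝒵 with hGT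
  set ET := ((lev m 1).powersetCard t).filter fun E => E ∈ 𝒳 ∧ E ∈ 𝒵 with hET
  obtain ⟨t', ht'⟩ : ∃ t', t = t' + 1 := ⟨t - 1, by omega⟩
  have htt : t - 1 = t' := by omega
  have h1n : 1 ≤ n := by omega
  have htn : t ≤ n := by omega
  -- liveness of the traces
  have hltX : ∀ s, ∀ U ∈ tr 𝒳 ∅ s, t ≤ #U := fun s U hU => hXt U (by simpa using (mem_tr.1 hU).2)
  have hltZ : ∀ s, ∀ U ∈ tr 𝒵 ∅ s, t ≤ #U := fun s U hU => hZt U (by simpa using (mem_tr.1 hU).2)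
  have hlX : ∀ s, ∀ U ∈ tr 𝒳 {d} s, t - 1 ≤ #U := fun s U hU => by
    have := hXt _ (mem_tr.1 hU).2; have := card_union_le ({d} : Finset α) U; rw [card_singleton] at this; omega
  have hlZ : ∀ s, ∀ U ∈ tr 𝒵 {d} s, t - 1 ≤ #U := fun s U hU => by
    have := hZt _ (mem_tr.1 hU).2; have := card_union_le ({d} : Finset α) U; rw [card_singleton] at this; omega
  have hcsL : ∀ s, s ⊆ lev m 1 → csetsT 𝒳 𝒵 {d} s (t - 1) = GT.filter fun w => w ⊆ s := fun s hs => by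
    ext w; simp only [csetsT, GT, mem_filter, mem_powersetCard, insert_eq]
    constructor
    · rintro ⟨⟨hws, hw2⟩, hX, hZ⟩; exact ⟨⟨⟨hws.trans hs, hw2⟩, hX, hZ⟩, hws⟩
    · rintro ⟨⟨⟨_, hw2⟩, hX, hZ⟩, hws⟩; exact ⟨⟨hws, hw2⟩, hX, hZ⟩
  -- sizes of the cubes
  have hnQ : ∀ Q ∈ (lev m 1).powersetCard (t - 1), #(insert d (lev m 1 \ Q)) = n + 1 := fun Q hQ => by
    rw [card_insert_of_notMem (fun h => hdT (mem_sdiff.1 h).1), card_sdiff_of_subset (mem_powersetCard.1 hQ).1,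
      (mem_powersetCard.1 hQ).2]; omega
  have hnE : ∀ E ∈ (lev m 1).powersetCard t, #(lev m 1 \ E) = n - 1 := fun E hE => by
    rw [card_sdiff_of_subset (mem_powersetCard.1 hE).1, (mem_powersetCard.1 hE).2]; omega
  have hGT' : ∀ w ∈ GT, w ⊆ lev m 1 ∧ #w = t - 1 := fun w hw => mem_powersetCard.1 (mem_filter.1 hw).1
  have hET' : ∀ w ∈ ET, w ⊆ lev m 1 ∧ #w = t := fun w hw => mem_powersetCard.1 (mem_filter.1 hw).1
  -- the partition of the common t-sets of a restriction cube into pinned and unpinned ones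
  have hsplit : ∀ Q ∈ (lev m 1).powersetCard (t - 1),
      (#(GT.filter fun w => w ⊆ lev m 1 \ Q) : ℤ) + #(ET.filter fun w => w ⊆ lev m 1 \ Q)
        ≤ #(csetsT 𝒳 𝒵 ∅ (insert d (lev m 1 \ Q)) t) := fun Q hQ => by
    have h1 := card_filter_le_pinnedT (𝒳 := 𝒳) (𝒵 := 𝒵) (s := lev m 1 \ Q) (t := t) hdT
    have h2 := card_filter_le_unpinnedT (𝒳 := 𝒳) (𝒵 := 𝒵) (s := lev m 1 \ Q) (t := t) hdT
    rw [show t - 1 + 1 = t from by omega] at h1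
    have h3 := card_filter_add_card_filter_not (s := csetsT 𝒳 𝒵 ∅ (insert d (lev m 1 \ Q)) t) (fun w => d ∈ w)
    have : #(GT.filter fun w => w ⊆ lev m 1 \ Q) + #(ET.filter fun w => w ⊆ lev m 1 \ Q) ≤ #(csetsT 𝒳 𝒵 ∅ (insert d (lev m 1 \ Q)) t) := by
      rw [← h3]; exact add_le_add h1 h2
    exact_mod_cast this
  -- double counting
  have dG : ∑ Q ∈ (lev m 1).powersetCard (t - 1), (#(GT.filter fun w => w ⊆ lev m 1 \ Q) : ℤ) = #GT * (n.choose (t - 1) : ℕ) := by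
    have := sum_card_filter_subset_sdiff hGT' (t - 1); rw [hn, show n + (t - 1) - (t - 1) = n from by omega] at this; exact_mod_cast this
  have dE : ∑ Q ∈ (lev m 1).powersetCard (t - 1), (#(ET.filter fun w => w ⊆ lev m 1 \ Q) : ℤ) = #ET * ((n - 1).choose (t - 1) : ℕ) := by
    have := sum_card_filter_subset_sdiff hET' (t - 1); rw [hn, show n + (t - 1) - t = n - 1 from by omega] at this; exact_mod_cast this
  have dL : ∑ E ∈ (lev m 1).powersetCard t, (#(GT.filter fun w => w ⊆ lev m 1 \ E) : ℤ) = #GT * (n.choose t : ℕ) := by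
    have := sum_card_filter_subset_sdiff hGT' t; rw [hn, show n + (t - 1) - (t - 1) = n from by omega] at this; exact_mod_cast this
  -- binomial identities (in ℕ, then ℤ)
  have ia : (n + 1) * n.choose (t - 1) = t * (n + 1).choose t := by
    rw [ht', show t' + 1 - 1 = t' from by omega, Nat.add_one_mul_choose_eq, mul_comm]
  have ic : n * (n - 1).choose (t - 1) = t * n.choose t := by
    obtain ⟨n', hn'⟩ : ∃ n', n = n' + 1 := ⟨n - 1, by omega⟩
    rw [hn', ht', show n' + 1 - 1 = n' from by omega, show t' + 1 - 1 = t' from by omega, Nat.add_one_mul_choose_eq, mul_comm]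
  have id' : (n + 1 - t) * (n + 1).choose t = (n + 1) * n.choose t := by
    have h1 := Nat.add_one_mul_choose_eq n t
    have h2 := Nat.choose_succ_right_eq (n + 1) t
    rw [mul_comm] at h2
    -- h1 : (n+1) * C(n,t) = C(n+1,t+1)*(t+1) ; h2 : (t+1) * C(n+1,t+1) = C(n+1,t) * (n+1-t)
    nlinarith [h1, h2]
  have iaZ : ((n : ℤ) + 1) * (n.choose (t - 1) : ℤ) = (t : ℤ) * ((n + 1).choose t : ℤ) := by exact_mod_cast ia
  have icZ : (n : ℤ) * ((n - 1).choose (t - 1) : ℤ) = (t : ℤ) * (n.choose t : ℤ) := by exact_mod_cast ic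
  have idZ : ((n : ℤ) + 1 - t) * ((n + 1).choose t : ℤ) = ((n : ℤ) + 1) * (n.choose t : ℤ) := by
    have := congrArg (fun k : ℕ => (k : ℤ)) id'; push_cast [Nat.cast_sub (show t ≤ n + 1 by omega)] at this; linarith
  have hCpos : (0 : ℤ) < ((n + 1).choose t : ℤ) := by exact_mod_cast Nat.choose_pos (by omega)
  have hCpos' : (0 : ℤ) < (n.choose t : ℤ) := by exact_mod_cast Nat.choose_pos htn
  have hCpos'' : (0 : ℤ) < (n.choose (t - 1) : ℤ) := by exact_mod_cast Nat.choose_pos (by omega)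
  have hCpos3 : (0 : ℤ) < ((n - 1).choose (t - 1) : ℤ) := by exact_mod_cast Nat.choose_pos (by omega)
  refine ⟨?_, ?_, ?_⟩
  · -- plain t-density on the restriction cubes
    have hP : ∀ Q ∈ (lev m 1).powersetCard (t - 1),
        (cH t (n + 1) : ℤ) * ((#(GT.filter fun w => w ⊆ lev m 1 \ Q) : ℤ) + #(ET.filter fun w => w ⊆ lev m 1 \ Q))
          ≤ ((n + 1).choose t : ℤ) * kap 𝒳 𝒵 ∅ (insert d (lev m 1 \ Q)) := fun Q hQ => by
      have h := densityT_le_kap h𝒳 h𝒵 t (n + 1) ∅ (insert d (lev m 1 \ Q)) (disjoint_empty_left _) (hnQ Q hQ) (hltX _) (hltZ _)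
      have h2 := mul_le_mul_of_nonneg_left (hsplit Q hQ) (show (0 : ℤ) ≤ cH t (n + 1) from Nat.cast_nonneg _)
      linarith
    have sP := sum_le_sum hP
    rw [← mul_sum, ← mul_sum, sum_add_distrib, dG, dE] at sP
    generalize hR : ∑ Q ∈ (lev m 1).powersetCard (t - 1), kap 𝒳 𝒵 ∅ (insert d (lev m 1 \ Q)) = R at sP ⊢
    generalize hg : (#GT : ℤ) = g at sP ⊢
    generalize hε : (#ET : ℤ) = ε at sP ⊢
    generalize hA : (cH t (n + 1) : ℤ) = A at sP ⊢
    generalize hC1 : ((n + 1).choose t : ℤ) = C1 at sP iaZ idZ hCpos ⊢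
    generalize hC2 : (n.choose (t - 1) : ℤ) = C2 at sP iaZ ⊢
    generalize hC3 : ((n - 1).choose (t - 1) : ℤ) = C3 at sP icZ ⊢
    generalize hC4 : (n.choose t : ℤ) = C4 at icZ idZ ⊢
    have hA0 : 0 ≤ A := by rw [← hA]; exact Nat.cast_nonneg _
    refine le_of_mul_le_mul_left ?_ hCpos
    have eq1 : C1 * (A * ((t : ℤ) * n * g + t * (n + 1 - t) * ε)) = (n : ℤ) * (n + 1) * (A * (g * C2 + ε * C3)) := by
      have e3 : (n : ℤ) * ((n : ℤ) + 1) * C3 = (t : ℤ) * (n + 1 - t) * C1 := by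
        have : (n : ℤ) * ((n : ℤ) + 1) * C3 = ((n : ℤ) + 1) * (n * C3) := by ring
        rw [this, icZ, show ((n : ℤ) + 1) * (t * C4) = t * ((n + 1) * C4) from by ring, ← idZ]; ring
      linear_combination (-(A * g * n)) * iaZ - (A * ε) * e3
    have eq2 : C1 * ((n : ℤ) * (n + 1) * R) = (n : ℤ) * (n + 1) * (C1 * R) := by ring
    rw [eq1, eq2]
    exact mul_le_mul_of_nonneg_left sP (by positivity)
  · -- pinned t-density at d on the restriction cubes
    have hP : ∀ Q ∈ (lev m 1).powersetCard (t - 1),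
        ((cH t n * n.choose t : ℕ) : ℤ) * #(GT.filter fun w => w ⊆ lev m 1 \ Q)
          + ((cH (t - 1) n * n.choose (t - 1) : ℕ) : ℤ) * #(ET.filter fun w => w ⊆ lev m 1 \ Q)
          ≤ ((n.choose (t - 1) * n.choose t : ℕ) : ℤ) * kap 𝒳 𝒵 ∅ (insert d (lev m 1 \ Q)) := fun Q hQ => by
      have h := pinnedT_le_kap h𝒳 h𝒵 (t - 1) n ∅ (insert d (lev m 1 \ Q)) d (disjoint_empty_left _) (hnQ Q hQ) (mem_insert_self d _)
        (by omega) (by rw [show t - 1 + 1 = t from by omega]; exact hltX _) (by rw [show t - 1 + 1 = t from by omega]; exact hltZ _)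
      rw [show t - 1 + 1 = t from by omega] at h
      have h1 := card_filter_le_pinnedT (𝒳 := 𝒳) (𝒵 := 𝒵) (s := lev m 1 \ Q) (t := t) hdT
      rw [show t - 1 + 1 = t from by omega] at h1
      have h2 := card_filter_le_unpinnedT (𝒳 := 𝒳) (𝒵 := 𝒵) (s := lev m 1 \ Q) (t := t) hdT
      have m1 := mul_le_mul_of_nonneg_left (show (#(GT.filter fun w => w ⊆ lev m 1 \ Q) : ℤ)
          ≤ #((csetsT 𝒳 𝒵 ∅ (insert d (lev m 1 \ Q)) t).filter fun w => d ∈ w) by exact_mod_cast h1)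
        (show (0 : ℤ) ≤ ((cH t n * n.choose t : ℕ) : ℤ) from Nat.cast_nonneg _)
      have m2 := mul_le_mul_of_nonneg_left (show (#(ET.filter fun w => w ⊆ lev m 1 \ Q) : ℤ)
          ≤ #((csetsT 𝒳 𝒵 ∅ (insert d (lev m 1 \ Q)) t).filter fun w => d ∉ w) by exact_mod_cast h2)
        (show (0 : ℤ) ≤ ((cH (t - 1) n * n.choose (t - 1) : ℕ) : ℤ) from Nat.cast_nonneg _)
      linarith
    have sP := sum_le_sum hP
    rw [sum_add_distrib, ← mul_sum, ← mul_sum, ← mul_sum, dG, dE] at sP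
    push_cast at sP
    generalize hR : ∑ Q ∈ (lev m 1).powersetCard (t - 1), kap 𝒳 𝒵 ∅ (insert d (lev m 1 \ Q)) = R at sP ⊢
    generalize hg : (#GT : ℤ) = g at sP ⊢
    generalize hε : (#ET : ℤ) = ε at sP ⊢
    generalize hPP : (cH t n : ℤ) = P at sP ⊢
    generalize hQQ : (cH (t - 1) n : ℤ) = Q' at sP ⊢
    generalize hC2 : (n.choose (t - 1) : ℤ) = C2 at sP hCpos'' ⊢
    generalize hC3 : ((n - 1).choose (t - 1) : ℤ) = C3 at sP icZ ⊢
    generalize hC4 : (n.choose t : ℤ) = C4 at sP icZ hCpos' ⊢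
    have hpos : 0 < C2 * C4 := mul_pos hCpos'' hCpos'
    refine le_of_mul_le_mul_left ?_ hpos
    have eq1 : C2 * C4 * ((n : ℤ) * P * g + t * Q' * ε) = n * (P * C4 * (g * C2)) + C2 * (Q' * ε * (t * C4)) := by ring
    have eq2 : C2 * C4 * ((n : ℤ) * R) = n * (C2 * C4 * R) := by ring
    rw [eq1, eq2, ← icZ]
    have h := mul_le_mul_of_nonneg_left sP (show (0 : ℤ) ≤ n from Nat.cast_nonneg _)
    linarith only [h]
  · -- (t−1)-density on the link cubes
    have hL : ∀ E ∈ (lev m 1).powersetCard t,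
        (cH (t - 1) (n - 1) : ℤ) * #(GT.filter fun w => w ⊆ lev m 1 \ E) ≤ ((n - 1).choose (t - 1) : ℤ) * kap 𝒳 𝒵 {d} (lev m 1 \ E) :=
        fun E hE => by
      have h := densityT_le_kap h𝒳 h𝒵 (t - 1) (n - 1) {d} (lev m 1 \ E) (disjoint_singleton_left.2 fun h => hdT (mem_sdiff.1 h).1) (hnE E hE)
        (hlX _) (hlZ _)
      rw [hcsL _ sdiff_subset] at h; exact h
    have sL := sum_le_sum hL
    rw [← mul_sum, ← mul_sum, dL] at sL
    generalize hL' : ∑ E ∈ (lev m 1).powersetCard t, kap 𝒳 𝒵 {d} (lev m 1 \ E) = L at sL ⊢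
    generalize hg : (#GT : ℤ) = g at sL ⊢
    generalize hRR : (cH (t - 1) (n - 1) : ℤ) = R₁ at sL ⊢
    generalize hC3 : ((n - 1).choose (t - 1) : ℤ) = C3 at sL icZ hCpos3 ⊢
    generalize hC4 : (n.choose t : ℤ) = C4 at sL icZ ⊢
    refine le_of_mul_le_mul_left ?_ hCpos3
    have eq1 : C3 * ((n : ℤ) * R₁ * g) = R₁ * (g * (n * C3)) := by ring
    rw [eq1, icZ]
    have h := mul_le_mul_of_nonneg_left sL (show (0 : ℤ) ≤ t from Nat.cast_nonneg _)
    linarith only [h]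

end RowOneT

end Summit.CriticalPhenomena.PercolationContinuityZ3.Theorems.SahiCTCForms
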